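import Literature.MathematicalPhysics.StatisticalMechanics.LennardJonesClusters
import Literature.MathematicalPhysics.StatisticalMechanics.MuGroundStateConfiguration
import Mathlib.Topology.MetricSpace.Infsep
import Mathlib.Topology.Algebra.InfiniteSum.Real
import Mathlib.Topology.Algebra.InfiniteSum.Order
import HarnessLib

/-!
# `μ`-ground-state configurations (Sütő), uniformly discrete sets, two-way matching on balls

Topic: `Literature/MathematicalPhysics/StatisticalMechanics`. Definition request `defn-IsMuGSC`
(route `AtomisticToContinuum/Crystallization/CoexistenceMuGSC`, items
`stmt-AtomisticToContinuum-4119/4120/4121/4128/4129/4130`, which inline the three notions below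
verbatim as `let`s; every definition here unfolds to the inlined text by `Iff.rfl`).

## Content

* `UniformlyDiscrete X` — a subset `X` of a (pseudo)metric space is *uniformly discrete* if some
  `δ > 0` bounds the distance of any two distinct points of `X` from below (Baake–Grimm 2013,
  §2.1: in `ℝᵈ` "uniform discreteness implies the existence of a minimum distance between
  distinct points"; we take the minimum-distance form as the definition). API: monotonicity,
  the Mathlib link `UniformlyDiscrete X ↔ 0 < X.einfsep`, finiteness of `X ∩ B̄_R(p)` in a
  finite-dimensional normed space (packing by volume), and — in `ℝ³` — summability over `X` of
  every radial field `y ↦ V(|r - y|)` with `|V(t)| ≤ C t⁻⁶` beyond some radius, in particular of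
  the Lennard-Jones field (shell counting, `sum_inv_pow_six_le` of `LennardJonesClusters.lean`).
* `Match δ R c A S` — *two-way `δ`-matching on the ball of radius `R` about `c`*: every point of
  `S` in the ball has a point of `A` within `δ`, and every point of `A` in the ball has a point of
  `S` within `δ` (the elementary closeness relation behind local / Chabauty–Fell convergence of
  point sets). API: monotone in `(δ, R)` (larger `δ`, smaller `R` is weaker), symmetric, reflexive.
* `fieldEnergy V x Y = ∑ᵢ ∑_{y ∈ Y} V(|xᵢ - y|)` — Sütő's interaction energy `I(R, Y)` of a finite
  configuration with an arbitrary one, for a radial pair potential `V : ℝ → ℝ` (an unconditional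
  sum over the point set `Y`).
* `IsMuGSC V μ X` — **`X ⊆ ℝᵈ` is a ground state configuration of `V` for chemical potential `μ`
  (a `μ`GSC)**, Sütő 2006, §2, Definition, in its second ("seemingly more general, but actually
  equivalent") form: "`X` is a `μ`GSC … if for any finite part `X_f` of `X` and any finite `R` …
  `U(R|X∖X_f) − μN_R ≥ U(X_f|X∖X_f) − μN_{X_f}`", where `U(R|X) = U(R) + I(R, X)`; together with
  the source's standing convergence convention ("If `X` is an infinite configuration, the
  infinite sum … has to be convergent"; Sütő 2011, Def. 7.1) made the first conjunct: all field
  sums `y ↦ V(|r - y|)` are summable over `X`. In words: no finite modification — remove the `n`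
  points `X_f`, insert `k` new points `R`, with arbitrary change `k - n` of the particle number —
  lowers `U − μ·#`. API: the removal test (`k = 0`), the insertion test (`n = 0`), the
  particle-conserving ("GSC") inequality (`k = n`), and the vacuum: `∅` is a `μ`GSC of `V` iff
  every configuration of `k` distinct points has energy `≥ μk`.

## Design choices and wording risks

* **Distinct points instead of `V(0) = +∞`** (as in `Crystallization.lean`, `groundStateEnergy`):
  the infinite configuration is a point SET `X` (no multiplicities), the removed part is given by
  an injective `xf : Fin n → ℝᵈ` with `range xf ⊆ X`, and the inserted configuration
  `R : Fin k → ℝᵈ` is injective with `range R` disjoint from `X ∖ range xf`. Sütő allows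
  coincident points (his `φ` is bounded); for potentials diverging at `0` (Lennard-Jones) the two
  readings agree, since coincidences have infinite printed energy.
* **Radial potentials.** Sütő's `φ` is a function of the difference vector; here, as everywhere in
  this topic (`interactionEnergy`), `V` is a function of the distance. `U(R)` is the tree's
  `interactionEnergy V R = ∑_{i<j} V(|Rᵢ - Rⱼ|)`.
* The canonical, particle-conserving notion for vector potentials `φ` and sequences is
  `Literature.Barriers.AtomisticToContinuum.Suto.IsGSC` (barrier catalogue); `IsMuGSC.exchange`
  below is the corresponding inequality in the present conventions. No separate radial `IsGSC`
  is introduced here (not requested).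
* `∑'` junk: `fieldEnergy` is a `tsum` (value `0` on a non-summable family); inside `IsMuGSC` the
  first conjunct makes every field sum over `X`, hence over `X ∖ range xf`, genuinely convergent.
* Nothing here is specific to Lennard-Jones except the two summability corollaries in `ℝ³`.

## Deduplication (2026-09-01, decomp-a2c UD-DEDUP)

The seven declarations `UniformlyDiscrete`, `UniformlyDiscrete.mono`, `uniformlyDiscrete_empty`,
`IsMuGSC`, `IsMuGSC.summable`, `IsMuGSC.le`, `isMuGSC_empty_iff`, formerly declared both here and in
`Literature/MathematicalPhysics/StatisticalMechanics/MuGroundStateConfiguration.lean` under the same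
fully qualified names (so that no module could import both files), are now IMPORTED from
`MuGroundStateConfiguration.lean`. `UniformlyDiscrete` is byte-identical there; `IsMuGSC` there is
written with the two field sums INLINE (`∑ i, ∑' y : ↥(X ∖ range xf), V (dist (xf i) y)`), which is
DEFINITIONALLY the `fieldEnergy` form of this file (`fieldEnergy V x Y := ∑ i, ∑' y : Y, V (dist (x i) y)`
unfolds to it): `isMuGSC_iff` (`Iff.rfl`) gives the inline text, `IsMuGSC.le_fieldEnergy` (the former
`IsMuGSC.le` of this file), `IsMuGSC.removal/insertion/exchange` give the `fieldEnergy` form, and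
`fieldEnergy_eq` rewrites between the two; `IsMuGSC.le` (of `MuGroundStateConfiguration.lean`) is the
inline form of the stability inequality. Two further statements that file also carries are kept here as
ALIASES of its theorems under this file's historical names: `uniformlyDiscrete_of_subsingleton`
(= `UniformlyDiscrete.of_subsingleton`) and `UniformlyDiscrete.summable_lennardJones`
(= `UniformlyDiscrete.summable_lennardJones_dist`).

## Sources

* A. Sütő, *From bcc to fcc: interplay between oscillating long-range and repulsive short-range
  forces*, Phys. Rev. B 74 (2006) 104117, arXiv:math-ph/0608041: §2, Definition (GSC, `μ`GSC),
  both forms, and the convergence convention preceding it (p. 5 of the arXiv version).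
* A. Sütő, Comm. Math. Phys. 305 (2011) 657–710: Definition 7.1 (absolute convergence of
  `I(X_f, X ∖ X_f)` as part of the definition).
* M. Baake, U. Grimm, *Aperiodic Order*, vol. 1 (2013), §2.1 (uniformly discrete point sets,
  Delone sets).
-/

noncomputable section

open scoped BigOperators
open Set Metric

namespace Literature.MathematicalPhysics.StatisticalMechanics

/-! ## Uniformly discrete sets -/

section UniformlyDiscrete

variable {α : Type*} [PseudoMetricSpace α]

/- `UniformlyDiscrete`, `UniformlyDiscrete.mono`, `uniformlyDiscrete_empty`: see
`MuGroundStateConfiguration.lean` (imported). -/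

/-- Unfolding lemma (the verbatim form inlined in route `CoexistenceMuGSC`). [folklore] -/
theorem uniformlyDiscrete_iff (X : Set α) :
    UniformlyDiscrete X ↔ ∃ δ : ℝ, 0 < δ ∧ ∀ x ∈ X, ∀ y ∈ X, x ≠ y → δ ≤ dist x y :=
  Iff.rfl

/-- A set with at most one point is uniformly discrete (this file's historical name; the theorem is
`UniformlyDiscrete.of_subsingleton` of `MuGroundStateConfiguration.lean`). [folklore] -/
alias uniformlyDiscrete_of_subsingleton := UniformlyDiscrete.of_subsingleton

/-- **Link with Mathlib.** A set is uniformly discrete iff its extended infimum separation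
`Set.einfsep` is positive. [folklore] -/
theorem uniformlyDiscrete_iff_einfsep_pos (X : Set α) : UniformlyDiscrete X ↔ 0 < X.einfsep := by
  rw [Set.einfsep_pos]
  constructor
  · rintro ⟨δ, hδ, h⟩
    refine ⟨ENNReal.ofReal δ, ENNReal.ofReal_pos.2 hδ, fun x hx y hy hxy => ?_⟩
    rw [edist_dist]
    exact ENNReal.ofReal_le_ofReal (h x hx y hy hxy)
  · rintro ⟨C, hC, h⟩
    rcases eq_or_ne C ⊤ with rfl | hCtop
    · exact ⟨1, one_pos, fun x hx y hy hxy =>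
        absurd (top_le_iff.1 (h x hx y hy hxy)) (edist_ne_top x y)⟩
    · refine ⟨C.toReal, ENNReal.toReal_pos hC.ne' hCtop, fun x hx y hy hxy => ?_⟩
      rw [dist_edist]
      exact ENNReal.toReal_mono (edist_ne_top x y) (h x hx y hy hxy)

/-- **Packing.** In a finite-dimensional real normed space, a uniformly discrete set meets every
closed ball in a finite set (at most `(2R/δ + 1)^{dim}` points, `card_le_of_separated_of_dist_le`).
[folklore] -/
theorem UniformlyDiscrete.finite_inter_closedBall {E : Type*} [NormedAddCommGroup E]
    [NormedSpace ℝ E] [FiniteDimensional ℝ E] {X : Set E} (hX : UniformlyDiscrete X) (p : E)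
    (R : ℝ) : (X ∩ Metric.closedBall p R).Finite := by
  obtain ⟨δ, hδ, hsep⟩ := hX
  rcases lt_or_ge R 0 with hR | hR
  · rw [Metric.closedBall_eq_empty.2 hR, Set.inter_empty]
    exact Set.finite_empty
  by_contra hinf
  obtain ⟨t, ht, hcard⟩ :=
    Set.Infinite.exists_subset_card_eq hinf (⌊(2 * R / δ + 1) ^ Module.finrank ℝ E⌋₊ + 1)
  have hle := card_le_of_separated_of_dist_le t p hδ hR
    (fun c hc => Metric.mem_closedBall.1 (ht hc).2)
    (fun c hc c' hc' hcc' => hsep c (ht hc).1 c' (ht hc').1 hcc')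
  rw [hcard] at hle
  have hlt := Nat.lt_floor_add_one ((2 * R / δ + 1) ^ Module.finrank ℝ E)
  push_cast at hle
  linarith

end UniformlyDiscrete

/-! ## Two-way matching on a ball -/

section Match

variable {α : Type*} [PseudoMetricSpace α]

/-- **Two-way `δ`-matching of `A` and `S` on the ball of radius `R` about `c`:** every point of
`S` within `R` of `c` has a point of `A` within `δ`, and every point of `A` within `R` of `c` has
a point of `S` within `δ` (partners need not lie in the ball). For `δ → 0`, `R → ∞` this is local
(Chabauty–Fell / "local topology") convergence of point sets. [folklore] -/
def Match (δ R : ℝ) (c : α) (A S : Set α) : Prop :=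
  (∀ s ∈ S, dist s c ≤ R → ∃ a ∈ A, dist a s ≤ δ) ∧ (∀ a ∈ A, dist a c ≤ R → ∃ s ∈ S, dist a s ≤ δ)

/-- Unfolding lemma (the verbatim form inlined in route `CoexistenceMuGSC`). [folklore] -/
theorem match_iff (δ R : ℝ) (c : α) (A S : Set α) :
    Match δ R c A S ↔
      (∀ s ∈ S, dist s c ≤ R → ∃ a ∈ A, dist a s ≤ δ) ∧
        (∀ a ∈ A, dist a c ≤ R → ∃ s ∈ S, dist a s ≤ δ) :=
  Iff.rfl

variable {δ δ' R R' : ℝ} {c : α} {A S : Set α}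

/-- **Monotonicity:** matching with tolerance `δ` on radius `R` implies matching with any larger
tolerance `δ' ≥ δ` on any smaller radius `R' ≤ R`. [folklore] -/
theorem Match.mono (h : Match δ R c A S) (hδ : δ ≤ δ') (hR : R' ≤ R) : Match δ' R' c A S :=
  ⟨fun s hs hsc =>
      let ⟨a, ha, has⟩ := h.1 s hs (hsc.trans hR)
      ⟨a, ha, has.trans hδ⟩,
    fun a ha hac =>
      let ⟨s, hs, has⟩ := h.2 a ha (hac.trans hR)
      ⟨s, hs, has.trans hδ⟩⟩

/-- Matching is symmetric in the two sets. [folklore] -/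
theorem Match.symm (h : Match δ R c A S) : Match δ R c S A :=
  ⟨fun a ha hac =>
      let ⟨s, hs, has⟩ := h.2 a ha hac
      ⟨s, hs, by rwa [dist_comm]⟩,
    fun s hs hsc =>
      let ⟨a, ha, has⟩ := h.1 s hs hsc
      ⟨a, ha, by rwa [dist_comm]⟩⟩

/-- Matching is symmetric in the two sets. [folklore] -/
theorem match_comm : Match δ R c A S ↔ Match δ R c S A :=
  ⟨Match.symm, Match.symm⟩

/-- Every set is `δ`-matched to itself, `δ ≥ 0`. [folklore] -/
theorem Match.refl (hδ : 0 ≤ δ) (R : ℝ) (c : α) (A : Set α) : Match δ R c A A :=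
  ⟨fun s hs _ => ⟨s, hs, by rwa [dist_self]⟩, fun a ha _ => ⟨a, ha, by rwa [dist_self]⟩⟩

end Match

/-! ## `μ`-ground-state configurations -/

section MuGSC

variable {d : ℕ}

/-- The interaction energy `I(R, Y) = ∑_{r ∈ R} ∑_{y ∈ Y} V(|r - y|)` of a finite configuration
`x = (x₁, …, x_N)` with an arbitrary configuration `Y ⊆ ℝᵈ` ("the energy of `R` in the field of
`Y`" is `U(R) + I(R, Y)`), for a radial pair potential `V`; the inner sum is unconditional
(`tsum`, junk value `0` when not summable). [cite: Suto2006, §2 (definition of I(R,X))] -/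
def fieldEnergy (V : ℝ → ℝ) {N : ℕ} (x : Fin N → EuclideanSpace ℝ (Fin d))
    (Y : Set (EuclideanSpace ℝ (Fin d))) : ℝ :=
  ∑ i, ∑' y : Y, V (dist (x i) y)

/-- Unfolding lemma. [folklore] -/
theorem fieldEnergy_eq (V : ℝ → ℝ) {N : ℕ} (x : Fin N → EuclideanSpace ℝ (Fin d))
    (Y : Set (EuclideanSpace ℝ (Fin d))) :
    fieldEnergy V x Y = ∑ i, ∑' y : Y, V (dist (x i) y) :=
  rfl

/-- The field of the empty configuration vanishes. [folklore] -/
@[simp] theorem fieldEnergy_empty (V : ℝ → ℝ) {N : ℕ} (x : Fin N → EuclideanSpace ℝ (Fin d)) :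
    fieldEnergy V x (∅ : Set (EuclideanSpace ℝ (Fin d))) = 0 := by
  simp [fieldEnergy]

/-- The field energy of the empty finite configuration vanishes. [folklore] -/
@[simp] theorem fieldEnergy_fin_zero (V : ℝ → ℝ) (x : Fin 0 → EuclideanSpace ℝ (Fin d))
    (Y : Set (EuclideanSpace ℝ (Fin d))) : fieldEnergy V x Y = 0 := by
  simp [fieldEnergy]

/- `IsMuGSC`, `IsMuGSC.summable`, `IsMuGSC.le`, `isMuGSC_empty_iff`: see
`MuGroundStateConfiguration.lean` (imported); `IsMuGSC V μ X` unfolds to the inline text of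
`isMuGSC_iff` below, i.e. to `… interactionEnergy V xf + fieldEnergy V xf (X ∖ range xf) - μ * n ≤ …`
with `fieldEnergy` unfolded. -/

/-- Unfolding lemma: `IsMuGSC V μ X` is, by `Iff.rfl`, the text inlined as `let MuGSC := …` in
route `CoexistenceMuGSC` (there with `V = lennardJones`, `d = 3`); explicit-argument twin of the
definition in `MuGroundStateConfiguration.lean`. [folklore] -/
theorem isMuGSC_iff (V : ℝ → ℝ) (μ : ℝ) (X : Set (EuclideanSpace ℝ (Fin d))) :
    IsMuGSC V μ X ↔
      (∀ r : EuclideanSpace ℝ (Fin d), Summable fun y : X => V (dist r y)) ∧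
        ∀ (n : ℕ) (xf : Fin n → EuclideanSpace ℝ (Fin d)), Function.Injective xf →
          Set.range xf ⊆ X → ∀ (k : ℕ) (R : Fin k → EuclideanSpace ℝ (Fin d)),
            Function.Injective R → Disjoint (Set.range R) (X \ Set.range xf) →
              interactionEnergy V xf +
                    (∑ i, ∑' y : ↥(X \ Set.range xf), V (dist (xf i) y)) - μ * n ≤
                interactionEnergy V R +
                    (∑ i, ∑' y : ↥(X \ Set.range xf), V (dist (R i) y)) - μ * k :=
  Iff.rfl

namespace IsMuGSC

variable {V : ℝ → ℝ} {μ : ℝ} {X : Set (EuclideanSpace ℝ (Fin d))}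

/-- The defining stability inequality of a `μ`GSC under a finite modification (remove `xf`,
insert `R`), `fieldEnergy` form (the statement of the former `IsMuGSC.le` of this file; definitionally
the inline-sum form `IsMuGSC.le` of `MuGroundStateConfiguration.lean`, `fieldEnergy_eq`).
[cite: Suto2006, §2 Definition (μGSC), second form] -/
theorem le_fieldEnergy (h : IsMuGSC V μ X) {n : ℕ} {xf : Fin n → EuclideanSpace ℝ (Fin d)}
    (hxf : Function.Injective xf) (hX : Set.range xf ⊆ X) {k : ℕ}
    {R : Fin k → EuclideanSpace ℝ (Fin d)} (hR : Function.Injective R)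
    (hdisj : Disjoint (Set.range R) (X \ Set.range xf)) :
    interactionEnergy V xf + fieldEnergy V xf (X \ Set.range xf) - μ * n ≤
      interactionEnergy V R + fieldEnergy V R (X \ Set.range xf) - μ * k :=
  h.2 n xf hxf hX k R hR hdisj

/-- **Removal test** (`k = 0`): in a `μ`GSC every finite part `X_f` of `n` points satisfies
`U(X_f) + I(X_f, X ∖ X_f) ≤ μ n` — no group of particles is bound by less than `-μ` per particle.
[cite: Suto2006, §2 Definition (μGSC), second form] -/
theorem removal (h : IsMuGSC V μ X) {n : ℕ} {xf : Fin n → EuclideanSpace ℝ (Fin d)}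
    (hxf : Function.Injective xf) (hX : Set.range xf ⊆ X) :
    interactionEnergy V xf + fieldEnergy V xf (X \ Set.range xf) ≤ μ * n := by
  have h0 : interactionEnergy V (Fin.elim0 : Fin 0 → EuclideanSpace ℝ (Fin d)) = 0 :=
    interactionEnergy_of_subsingleton V _
  have := h.le_fieldEnergy hxf hX (k := 0) (R := Fin.elim0) (Function.injective_of_subsingleton _)
    (by simp)
  rw [h0, fieldEnergy_fin_zero, Nat.cast_zero, mul_zero] at this
  linarith

/-- **Insertion test** (`n = 0`): in a `μ`GSC, `k` distinct new points `R` off `X` satisfy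
`μ k ≤ U(R) + I(R, X)` — no insertion gains more than `-μ` per particle.
[cite: Suto2006, §2 Definition (μGSC), second form] -/
theorem insertion (h : IsMuGSC V μ X) {k : ℕ} {R : Fin k → EuclideanSpace ℝ (Fin d)}
    (hR : Function.Injective R) (hdisj : Disjoint (Set.range R) X) :
    μ * k ≤ interactionEnergy V R + fieldEnergy V R X := by
  have h0 : interactionEnergy V (Fin.elim0 : Fin 0 → EuclideanSpace ℝ (Fin d)) = 0 :=
    interactionEnergy_of_subsingleton V _
  have he : X \ Set.range (Fin.elim0 : Fin 0 → EuclideanSpace ℝ (Fin d)) = X := by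
    rw [Set.range_eq_empty, Set.sdiff_empty]
  have := h.le_fieldEnergy (n := 0) (xf := Fin.elim0) (Function.injective_of_subsingleton _) (by simp)
    hR (by rw [he]; exact hdisj)
  rw [he, h0, fieldEnergy_fin_zero, Nat.cast_zero, mul_zero] at this
  linarith

/-- **Particle-conserving modifications** (`k = n`): a `μ`GSC is in particular a ground state
configuration in the canonical sense — `U(X_f) + I(X_f, X ∖ X_f) ≤ U(R) + I(R, X ∖ X_f)` whenever
`N_R = N_{X_f}` (Sütő 2006, Remark 4: "A `μ`GSC is, by definition, also a GSC"; cf.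
`Literature.Barriers.AtomisticToContinuum.Suto.IsGSC`). [cite: Suto2006, §2 Remark 4] -/
theorem exchange (h : IsMuGSC V μ X) {n : ℕ} {xf R : Fin n → EuclideanSpace ℝ (Fin d)}
    (hxf : Function.Injective xf) (hX : Set.range xf ⊆ X) (hR : Function.Injective R)
    (hdisj : Disjoint (Set.range R) (X \ Set.range xf)) :
    interactionEnergy V xf + fieldEnergy V xf (X \ Set.range xf) ≤
      interactionEnergy V R + fieldEnergy V R (X \ Set.range xf) := by
  have := h.le_fieldEnergy hxf hX hR hdisj
  linarith

end IsMuGSC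

/-- For a non-negative potential and `μ ≤ 0` the vacuum is a `μ`GSC (non-vacuity of the notion).
[folklore] -/
theorem isMuGSC_empty_of_nonneg {V : ℝ → ℝ} {μ : ℝ} (hV : ∀ t, 0 ≤ V t) (hμ : μ ≤ 0) :
    IsMuGSC V μ (∅ : Set (EuclideanSpace ℝ (Fin d))) :=
  isMuGSC_empty_iff.2 fun k _ _ =>
    ((mul_le_mul_of_nonneg_right hμ (Nat.cast_nonneg k)).trans_eq (zero_mul _)).trans
      (Finset.sum_nonneg fun _ _ => Finset.sum_nonneg fun _ _ => hV _)

end MuGSC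

/-! ## Summability of fields over uniformly discrete sets in `ℝ³` -/

section Summability

/-- **Shell sum about an external centre.** If the points of a finite set `t ⊆ ℝ³` are pairwise
`≥ η` apart and all at distance `≥ η` from `p`, then `∑_{z ∈ t} |p - z|⁻⁶ ≤ 250 η⁻⁶`
(`sum_inv_pow_six_le` applied to the configuration `(p, t)`). [folklore] -/
theorem sum_inv_pow_six_le_of_le_dist (t : Finset (EuclideanSpace ℝ (Fin 3)))
    (p : EuclideanSpace ℝ (Fin 3)) {η : ℝ} (hη : 0 < η) (hp : ∀ z ∈ t, η ≤ dist p z)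
    (ht : ∀ z ∈ t, ∀ w ∈ t, z ≠ w → η ≤ dist z w) :
    ∑ z ∈ t, (dist p z)⁻¹ ^ 6 ≤ 250 * η⁻¹ ^ 6 := by
  classical
  set e := t.equivFin
  set x : Fin (t.card + 1) → EuclideanSpace ℝ (Fin 3) :=
    Fin.cons p fun j => ((e.symm j : t) : EuclideanSpace ℝ (Fin 3)) with hx_def
  have hx0 : x 0 = p := rfl
  have hxs : ∀ j : Fin t.card, x j.succ = ((e.symm j : t) : EuclideanSpace ℝ (Fin 3)) :=
    fun j => Fin.cons_succ _ _ j
  have hsep : ∀ k l, k ≠ l → η ≤ dist (x k) (x l) := by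
    intro k l hkl
    rcases Fin.eq_zero_or_eq_succ k with rfl | ⟨i, rfl⟩ <;>
      rcases Fin.eq_zero_or_eq_succ l with rfl | ⟨j, rfl⟩
    · exact absurd rfl hkl
    · rw [hx0, hxs]
      exact hp _ (e.symm j).2
    · rw [hx0, hxs, dist_comm]
      exact hp _ (e.symm i).2
    · rw [hxs, hxs]
      exact ht _ (e.symm i).2 _ (e.symm j).2 fun hij =>
        hkl (congrArg Fin.succ (e.symm.injective (Subtype.coe_injective hij)))
  have key := sum_inv_pow_six_le x hη hsep 0
  have hre : ∑ k ∈ Finset.univ.erase (0 : Fin (t.card + 1)), (dist (x 0) (x k))⁻¹ ^ 6 =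
      ∑ z ∈ t, (dist p z)⁻¹ ^ 6 := by
    rw [Finset.sum_erase_eq_sub (Finset.mem_univ _), Fin.sum_univ_succ, hx0, dist_self, inv_zero,
      zero_pow (by norm_num), zero_add, sub_zero]
    simp_rw [hxs]
    rw [Fintype.sum_equiv e.symm (fun i => (dist p ((e.symm i : t) : EuclideanSpace ℝ (Fin 3)))⁻¹ ^ 6)
      (fun z => (dist p (z : EuclideanSpace ℝ (Fin 3)))⁻¹ ^ 6) (fun _ => rfl)]
    exact Finset.sum_coe_sort t (fun z => (dist p z)⁻¹ ^ 6)
  rw [hre] at key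
  exact key

/-- **Fields with an `r⁻⁶` tail are summable over uniformly discrete sets in `ℝ³`.** If
`X ⊆ ℝ³` is uniformly discrete and `|V(t)| ≤ C t⁻⁶` for `t ≥ ρ > 0`, then for every `r ∈ ℝ³`
the field `y ↦ V(|r - y|)` is (absolutely) summable over `X`: finitely many points of `X` lie
within `ρ` of `r` (packing), and the rest contribute at most `250 C η⁻⁶`, `η = min(δ, ρ)`, to
every partial sum (shell counting). [folklore] -/
theorem UniformlyDiscrete.summable_of_abs_le_inv_pow_six {X : Set (EuclideanSpace ℝ (Fin 3))}
    (hX : UniformlyDiscrete X) {V : ℝ → ℝ} {C ρ : ℝ} (hρ : 0 < ρ)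
    (hV : ∀ t, ρ ≤ t → |V t| ≤ C * t⁻¹ ^ 6) (r : EuclideanSpace ℝ (Fin 3)) :
    Summable fun y : X => V (dist r y) := by
  classical
  have hfin : (X ∩ Metric.closedBall r ρ).Finite := hX.finite_inter_closedBall r ρ
  obtain ⟨δ, hδ, hsep⟩ := hX
  obtain ⟨η, hη, hηδ, hηρ⟩ : ∃ η : ℝ, 0 < η ∧ η ≤ δ ∧ η ≤ ρ :=
    ⟨min δ ρ, lt_min hδ hρ, min_le_left _ _, min_le_right _ _⟩
  have hC : 0 ≤ C := by
    have h1 := hV ρ le_rfl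
    have h2 : 0 < ρ⁻¹ ^ 6 := by positivity
    nlinarith [abs_nonneg (V ρ)]
  refine Summable.of_abs (summable_of_sum_le
    (c := (∑ z ∈ hfin.toFinset, |V (dist r z)|) + C * (250 * η⁻¹ ^ 6))
    (fun y => abs_nonneg _) fun u => ?_)
  rw [← Finset.sum_filter_add_sum_filter_not u (fun y : X => dist r y ≤ ρ)]
  refine add_le_add ?_ ?_
  · -- near points: finitely many, fixed
    calc ∑ y ∈ u.filter (fun y : X => dist r y ≤ ρ), |V (dist r y)|
        = ∑ z ∈ (u.filter (fun y : X => dist r y ≤ ρ)).image Subtype.val, |V (dist r z)| := by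
          rw [Finset.sum_image fun a _ b _ h => Subtype.val_injective h]
      _ ≤ ∑ z ∈ hfin.toFinset, |V (dist r z)| := by
          refine Finset.sum_le_sum_of_subset_of_nonneg (fun z hz => ?_) fun _ _ _ => abs_nonneg _
          simp only [Finset.mem_image, Finset.mem_filter] at hz
          obtain ⟨y, ⟨-, hy⟩, rfl⟩ := hz
          rw [Set.Finite.mem_toFinset]
          exact ⟨y.2, Metric.mem_closedBall'.2 hy⟩
  · -- far points: shell counting
    set uf := u.filter (fun y : X => ¬ dist r y ≤ ρ) with huf
    set t : Finset (EuclideanSpace ℝ (Fin 3)) := uf.image Subtype.val with ht_def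
    have htX : ∀ z ∈ t, z ∈ X := fun z hz => by
      obtain ⟨y, -, rfl⟩ := Finset.mem_image.1 hz
      exact y.2
    have htfar : ∀ z ∈ t, ρ < dist r z := fun z hz => by
      obtain ⟨y, hy, rfl⟩ := Finset.mem_image.1 hz
      exact not_le.1 (Finset.mem_filter.1 hy).2
    have hsum_eq : ∑ y ∈ uf, |V (dist r y)| = ∑ z ∈ t, |V (dist r z)| := by
      rw [Finset.sum_image fun a _ b _ h => Subtype.val_injective h]
    rw [hsum_eq]
    calc ∑ z ∈ t, |V (dist r z)|
        ≤ ∑ z ∈ t, C * (dist r z)⁻¹ ^ 6 := Finset.sum_le_sum fun z hz => hV _ (htfar z hz).le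
      _ = C * ∑ z ∈ t, (dist r z)⁻¹ ^ 6 := (Finset.mul_sum _ _ _).symm
      _ ≤ C * (250 * η⁻¹ ^ 6) := by
          refine mul_le_mul_of_nonneg_left ?_ hC
          exact sum_inv_pow_six_le_of_le_dist t r hη (fun z hz => hηρ.trans (htfar z hz).le)
            fun z hz w hw hzw => hηδ.trans (hsep z (htX z hz) w (htX w hw) hzw)

/-- `|V_LJ(t)| ≤ t⁻⁶/4` for `t ≥ 1` (`V_LJ = u²/12 − u/6`, `u = t⁻⁶ ∈ [0, 1]`).
[cite: BlancLewin2015, §1.1 (3)] -/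
theorem abs_lennardJones_le {t : ℝ} (ht : 1 ≤ t) : |lennardJones t| ≤ 1 / 4 * t⁻¹ ^ 6 := by
  have h0 : 0 ≤ t⁻¹ := inv_nonneg.2 (by linarith)
  have h1 : t⁻¹ ≤ 1 := inv_le_one_of_one_le₀ ht
  have h6 : 0 ≤ t⁻¹ ^ 6 := pow_nonneg h0 6
  have h6' : t⁻¹ ^ 6 ≤ 1 := pow_le_one₀ h0 h1
  have h12 : t⁻¹ ^ 12 = t⁻¹ ^ 6 * t⁻¹ ^ 6 := by ring
  rw [abs_le]
  unfold lennardJones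
  rw [h12]
  constructor <;> nlinarith [mul_le_mul_of_nonneg_left h6' h6, mul_nonneg h6 h6]

/-- **Lennard-Jones fields are summable over uniformly discrete subsets of `ℝ³`** (the first
conjunct of `IsMuGSC lennardJones μ X` is automatic for uniformly discrete `X`): `r⁻⁶` tail and
shell counting. This file's historical name, kept for its importers; the theorem is
`UniformlyDiscrete.summable_lennardJones_dist` of `MuGroundStateConfiguration.lean` (same statement;
also `hX.summable_of_abs_le_inv_pow_six one_pos (fun _ ht => abs_lennardJones_le ht) r`). [folklore] -/
alias UniformlyDiscrete.summable_lennardJones := UniformlyDiscrete.summable_lennardJones_dist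

end Summability

end Literature.MathematicalPhysics.StatisticalMechanics

end
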